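import Summits.BirchSwinnertonDyer.Rank1Residual.Iwasawa.SelmerCardOfLevelZeroControlTamagawa
import Literature.NumberTheory.EllipticCurves.Greenberg1999.NoProperFiniteIndexSubmodule
import Literature.NumberTheory.EllipticCurves.BSDQuadraticDescentShaOddPartProofs
import Literature.NumberTheory.EllipticCurves.PAdicBSDKatoFiniteProofs
import HarnessLib

/-!
# The UPPER half of control WITHOUT Poitou–Tate: `X[T] = 0` (no non-zero finite `Λ`-submodule,
# Greenberg's Prop. 4.14 / Hachimori–Matsuno) ⟹ `(Sel_∞)_γ = 0` ⟹
# `f(0) · #E[p^∞]^{Γ_K} = u · #Sel_{p^∞}(E/K) · #ker g_0` EXACTLY, hence `#Sel_{p^∞}(E/K) · #ker g_0 ∣ f(0)`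
# (team n1011, row T-CTL-UP, seat p06 GEN 11, FILE 1 — TOOL, K-general + the `ℚ` reading mod Prop. 4.14)

HONEST FRAMING (cell `b2b-bsdres-*`, team n1011, verbatim): prove what is provable now; shrink each
hard class to its core with data; no claim beyond stated classes. Research route; TOOL theorems
only — no definition, no named fact, nothing booked, no residual-map mark moved, no class closed.
Greenberg's Prop. 4.14 enters ONLY as the explicit binder
`(h414 : Greenberg1999.prop414_noFiniteSubmodule_of_not_dvd_torsionOrder)` (registered record,
`Literature/…/Greenberg1999/NoProperFiniteIndexSubmodule`), in §4 only.

## What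

Rows T-CTL-EC / T-CTL-TAM (`Iwasawa/SelmerCardOfLevelZeroControl`, `Iwasawa/KerGZeroCardDvdProd`,
`Iwasawa/SelmerCardOfLevelZeroControlTamagawa`) read the tree's Thm-4.1 skeleton
`f(0) · #(Sel_∞)_γ · #E[p^∞]^{Γ_K} = u · #Sel_{p^∞}(E/K) · #ker g_0`
(`SelmerDualData.constantCoeff_charGenerator_mul_natCard_of_finite_selmerGroup`: Greenberg's Lemmas
4.2 × 4.3, any number field, any `ℤ_p`-extension) in the LOWER direction `f(0) ∣ #Sel · #ker g_0`,
where the unknown finite group `(Sel_∞)_γ = H¹(Γ, Sel_∞)` is harmless. The UPPER direction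
`#Sel · #ker g_0 ∣ f(0) · (…)` needs `(Sel_∞)_γ` killed. Greenberg does this with Lemma 4.7
(Cassels–Poitou–Tate). THIS FILE kills it from the STRUCTURE of `X = X(E/K_∞)` instead: by Pontryagin
duality `#(Sel_∞)_γ = #X[T]` (tree `IsDualPair.natCard_invariants`), `X[T] = X^Γ` is a FINITE
`Λ`-SUBMODULE of `X` (finite because `f(0) ≠ 0`), so it VANISHES as soon as `X` has no non-zero
finite `Λ`-submodule — Greenberg's Prop. 4.14 (`E(K)[p] = 0`, `X` torsion; LNM 1716 §4) in the dual
form of Hachimori–Matsuno (Proc. AMS 128 (2000), Cor. (i)), a registered record of the tree for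
`K = ℚ`. Hence, for `E = W` elliptic over a number field `K`, ANY `ℤ_p`-extension `κ` with topological
generator `γ`, any dual datum `D`, any generator `f` of `char_Λ X`:

* `natCard_endCoinvariants_eq_one_of_forall_finite_eq_bot` — no non-zero finite `Λ`-submodule and
  `(Sel_∞)_γ` finite ⟹ **`#(Sel_∞)_γ = 1`**;
* `constantCoeff_mul_natCard_fixedPoints_eq_of_forall_finite_eq_bot` — `Sel_{p^∞}(E/K)`, `ker g_0`,
  `E(K_∞)[p^∞]` finite, no finite submodule ⟹ **`f(0) · #E[p^∞]^{Γ_K} = u · #Sel · #ker g_0`**, `u ∈ ℤ_pˣ`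
  (the skeleton with `H¹(Γ, Sel_∞)` GONE); `…_of_no_pTorsion` (`E(K)[p] = 0`): **`f(0) = u · #Sel · #ker g_0`**;
* `natCard_selmer_mul_natCard_kerG_dvd_constantCoeff_of_no_pTorsion[_of_good]` —
  **`#Sel_{p^∞}(E/K) · #ker g_0 ∣ f(0)`** in `ℤ_p`: the UPPER half of control with NO local input (the
  `_of_good` form makes `ker g_0` finite by FILE T-CTL-TAM 1; above `p` only FINITENESS of `𝒦_{v,0}[p^∞]`);
  `…_and_dvd_…` — TWO-SIDED: `#Sel · #ker g_0 ∣ f(0) ∣ #Sel · ∏_{v∈S} #𝒦_{v,0}[p^∞]`;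
  `constantCoeff_eq_unit_mul_natCard_selmer_of_localTowerKerPrimary_eq_bot` — on TRIVIAL-KERNEL rows
  **`f(0) = u · #Sel_{p^∞}(E/K)` EXACTLY** (the Perrin-Riou–Schneider / Thm. 4.1 value there, modulo
  the no-finite-submodule input only);
* §4, `K = ℚ`, the record BY NAME (`…_of_prop414`): `W` globally minimal, `p ∤ #E(ℚ)_tors`, `κ`
  cyclotomic, `Sel_{p^∞}(E/ℚ)` finite, `𝒦_{v,0}[p^∞]` finite above `p` on `S ⊇ {p} ∪ {bad}` ⟹
  `#Sel · #ker g_0 ∣ f(0)`, `#Sel ∣ g(0)` for EVERY `g ∈ char_Λ X`, and in rank `0`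
  **`#Ш(E/ℚ)[p^∞] ∣ g(0)`** (`natCard_primaryComponent_sha_dvd_constantCoeff_of_prop414`).

NOT claimed: the Tamagawa factor of Greenberg's Thm. 4.1 / Delbourgo 1998 Prop. 4 on the upper side
(`#ker g_0 ≥ ∏ c_v^{(p)}` is the global-duality input, Cassels–Poitou–Tate / Lemma 4.7); on rows with
`p ∣ c_v` at some `v ∤ p` the upper half below is correspondingly weaker than print. Axioms standard.

References: [GreenbergLNM1716] §4 Thm. 4.1, Lemmas 4.2–4.3 (pp. 102–104), Prop. 4.14 (§4), §3
Lemma 3.5 (p. 90); [HachimoriMatsuno2000] Cor. (i) (p. 2540); cells/n1011/skel/T-CTL-UP.md.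
-/

noncomputable section

open scoped Classical

universe u

namespace Summit.BirchSwinnertonDyer.Rank1Residual.Iwasawa

open Literature.NumberTheory.EllipticCurves Literature.NumberTheory.EllipticCurves.IwasawaDual
  Literature.NumberTheory.EllipticCurves.IwasawaAlgebra
  Literature.NumberTheory.GaloisRepresentations NumberField IsDedekindDomain WeierstrassCurve

/-! ## §1. `(Sel_∞)_γ = 0` from "no non-zero finite `Λ`-submodule" -/

section Coinvariants

variable {K : Type u} [Field K] [NumberField K] (W : WeierstrassCurve K)
  {p : ℕ} [hp : Fact p.Prime] {κ : ZpExtension K p} {γ : Field.absoluteGaloisGroup K}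

/-- **`#(Sel_∞)_γ = 1` when `X(E/K_∞)` has no non-zero finite `Λ`-submodule.** For any
`ℤ_p`-extension `K_∞/K` with topological generator `γ` and any Pontryagin-dual datum `D`: if every
finite `Λ`-submodule of `X = D.X` is `0` and `(Sel_∞)_γ = Sel_∞/(γ−1)` is finite, then
`#(Sel_∞)_γ = 1`. Indeed `#X[T] = #(Sel_∞)_γ` (`IsDualPair.natCard_invariants`: `X[T] ≅ Hom((Sel_∞)_γ, ℚ/ℤ)`),
so `X[T] = X^Γ` is a finite `Λ`-submodule of `X`, hence `⊥`. (Dual of Greenberg's "`Sel_E(F_∞)_p` has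
no proper `Λ`-submodule of finite index", Prop. 4.14; HaMa Cor. (i).)
[cite: GreenbergLNM1716, §4 Prop. 4.14 and §1 p. 60] [cite: HachimoriMatsuno2000, Corollary (i) (p. 2540)] -/
theorem natCard_endCoinvariants_eq_one_of_forall_finite_eq_bot
    (D : W.SelmerDualData κ γ) (hγ : κ.IsTopGenerator γ)
    (hnf : ∀ N : Submodule (IwasawaAlgebra p) D.X, Finite N → N = ⊥)
    (hfin : Finite (EndCoinvariants (W.conjSelmerInfty κ γ - 1))) :
    Nat.card (EndCoinvariants (W.conjSelmerInfty κ γ - 1)) = 1 := by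
  have hdual := D.isDualPair W hγ
  have hXT : Finite (invariants p D.X) := hdual.finite_invariants_iff.mpr hfin
  rw [← hdual.natCard_invariants, hnf _ hXT]
  exact Nat.card_unique

end Coinvariants

/-! ## §2. The Thm-4.1 skeleton with `H¹(Γ, Sel_∞)` gone -/

section Identity

variable {K : Type u} [Field K] [NumberField K] (W : WeierstrassCurve K) [W.IsElliptic]
  {p : ℕ} [hp : Fact p.Prime] {κ : ZpExtension K p} {γ : Field.absoluteGaloisGroup K}

omit [W.IsElliptic] in
/-- **`f(0) · #E[p^∞]^{Γ_K} = u · #Sel_{p^∞}(E/K) · #ker g_0` — Greenberg's Thm. 4.1 skeleton with the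
coinvariants KILLED by structure.** For `E = W` elliptic over a number field `K`, ANY `ℤ_p`-extension
`κ` with topological generator `γ`, any dual datum `D`: if `Sel_{p^∞}(E/K)`, `ker g_0 = A_0/Sel_0` and
`B = E(K_∞)[p^∞]` are finite, and `X(E/K_∞)` — which is then finitely generated `Λ`-torsion — has no
non-zero finite `Λ`-submodule (`hnf`, asked only under those two conclusions), then for every
generator `f` of `char_Λ X`: `f(0) ≠ 0`, `#(Sel_∞)_γ = 1`, and
`f(0) · #E[p^∞]^{Γ_K} = u · #Sel_{p^∞}(E/K) · #ker g_0` for a unit `u ∈ ℤ_pˣ`. (Lemma 4.2 × Lemma 4.3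
as assembled in the tree, then §1.) NO Lemma 4.4 / 4.7, no local input.
[cite: GreenbergLNM1716, §4 Thm. 4.1 (proof, pp. 102–104) and Prop. 4.14] -/
theorem constantCoeff_mul_natCard_fixedPoints_eq_of_forall_finite_eq_bot
    (D : W.SelmerDualData κ γ) (hγ : κ.IsTopGenerator γ) (hSel : Finite ↥(W.selmerGroupPInfty p))
    (hg : Finite (W.KerG κ 0))
    [Finite (FixedPoints.addSubgroup κ.kerSubgroup (geomPrimaryTorsion W p))]
    (hnf : Module.Finite (IwasawaAlgebra p) D.X → Module.IsTorsion (IwasawaAlgebra p) D.X →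
      ∀ N : Submodule (IwasawaAlgebra p) D.X, Finite N → N = ⊥)
    (f : IwasawaAlgebra p) (hf : D.charIdeal = Ideal.span {f}) :
    Module.Finite (IwasawaAlgebra p) D.X ∧ Module.IsTorsion (IwasawaAlgebra p) D.X ∧
      PowerSeries.constantCoeff f ≠ 0 ∧ Nat.card (EndCoinvariants (W.conjSelmerInfty κ γ - 1)) = 1 ∧
      ∃ u : ℤ_[p]ˣ,
        PowerSeries.constantCoeff f *
            (Nat.card (MulAction.fixedPoints (Field.absoluteGaloisGroup K) (geomPrimaryTorsion W p)) :
              ℤ_[p]) =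
          u * Nat.card ↥(W.selmerGroupPInfty p) * Nat.card (W.KerG κ 0) := by
  obtain ⟨hFG, hX, -, h1, hf0, u, hu⟩ :=
    D.constantCoeff_charGenerator_mul_natCard_of_finite_selmerGroup W hγ hSel hg f hf
  have hone : Nat.card (EndCoinvariants (W.conjSelmerInfty κ γ - 1)) = 1 :=
    natCard_endCoinvariants_eq_one_of_forall_finite_eq_bot W D hγ (hnf hFG hX) h1
  refine ⟨hFG, hX, hf0, hone, u, ?_⟩
  rw [hone, Nat.cast_one, mul_one] at hu
  exact hu

/-- **`f(0) = u · #Sel_{p^∞}(E/K) · #ker g_0`** when moreover `E(K)[p] = 0` (then `E(K_∞)[p^∞] = 0`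
and `#E[p^∞]^{Γ_K} = 1`, tree `IwasawaTowerTorsionProofs`). The EXACT Euler-characteristic identity
of the rank-`0` control theorem modulo the no-finite-submodule input; `ker g_0 = A_0/Sel_0` counted,
not assumed trivial. [cite: GreenbergLNM1716, §4 Thm. 4.1 (proof, pp. 102–104) and Prop. 4.14] -/
theorem constantCoeff_eq_unit_mul_natCard_selmer_mul_natCard_kerG_of_no_pTorsion
    (D : W.SelmerDualData κ γ) (hγ : κ.IsTopGenerator γ) (hSel : Finite ↥(W.selmerGroupPInfty p))
    (hg : Finite (W.KerG κ 0)) (hK : ∀ P : W.toAffine.Point, p • P = 0 → P = 0)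
    (hnf : Module.Finite (IwasawaAlgebra p) D.X → Module.IsTorsion (IwasawaAlgebra p) D.X →
      ∀ N : Submodule (IwasawaAlgebra p) D.X, Finite N → N = ⊥)
    (f : IwasawaAlgebra p) (hf : D.charIdeal = Ideal.span {f}) :
    Module.Finite (IwasawaAlgebra p) D.X ∧ Module.IsTorsion (IwasawaAlgebra p) D.X ∧
      PowerSeries.constantCoeff f ≠ 0 ∧ Nat.card (EndCoinvariants (W.conjSelmerInfty κ γ - 1)) = 1 ∧
      ∃ u : ℤ_[p]ˣ,
        PowerSeries.constantCoeff f =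
          u * Nat.card ↥(W.selmerGroupPInfty p) * Nat.card (W.KerG κ 0) := by
  haveI := W.finite_fixedPoints_kerSubgroup_geomPrimaryTorsion κ hK
  obtain ⟨hFG, hX, hf0, hone, u, hu⟩ :=
    constantCoeff_mul_natCard_fixedPoints_eq_of_forall_finite_eq_bot W D hγ hSel hg hnf f hf
  refine ⟨hFG, hX, hf0, hone, u, ?_⟩
  rwa [W.natCard_fixedPoints_absoluteGaloisGroup_geomPrimaryTorsion_eq_one hK, Nat.cast_one,
    mul_one] at hu

end Identity

/-! ## §3. The UPPER half of control: `#Sel_{p^∞}(E/K) · #ker g_0 ∣ f(0)` -/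

section Upper

variable {K : Type u} [Field K] [NumberField K] (W : WeierstrassCurve K) [W.IsElliptic]
  {p : ℕ} [hp : Fact p.Prime] {κ : ZpExtension K p} {γ : Field.absoluteGaloisGroup K}

variable (κ) in
/-- On a finite set `S` of places the level-`0` kernels `𝒦_{v,0}[p^∞]` are finite as soon as they are
finite ABOVE `p`: at `v ∤ p` this is Greenberg's Lemma 3.3 (tree `finite_localTowerKerPrimary_zero_of_not_mem`).
[cite: GreenbergLNM1716, §3 Lemma 3.3 (pp. 86–87)] -/
theorem finite_localTowerKerPrimary_zero_on_finset (S : Finset (HeightOneSpectrum (𝓞 K)))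
    (hSp : ∀ v ∈ S, (p : 𝓞 K) ∈ v.asIdeal → Finite (W.localTowerKerPrimary κ (v.adicCompletion K) 0)) :
    ∀ v ∈ S, Finite (W.localTowerKerPrimary κ (v.adicCompletion K) 0) := by
  intro v hv
  by_cases hpv : (p : 𝓞 K) ∈ v.asIdeal
  · exact hSp v hv hpv
  · exact W.finite_localTowerKerPrimary_zero_of_not_mem κ hpv

omit [W.IsElliptic] in
/-- **`#Sel_{p^∞}(E/K) · #ker g_0 ∣ f(0) · #E[p^∞]^{Γ_K}` in `ℤ_p`** (`Sel`, `ker g_0`, `E(K_∞)[p^∞]`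
finite; no finite submodule): the upper half of control with the torsion factor displayed.
[cite: GreenbergLNM1716, §4 Thm. 4.1 (proof, pp. 102–104) and Prop. 4.14] -/
theorem natCard_selmer_mul_natCard_kerG_dvd_constantCoeff_mul_natCard_fixedPoints
    (D : W.SelmerDualData κ γ) (hγ : κ.IsTopGenerator γ) (hSel : Finite ↥(W.selmerGroupPInfty p))
    (hg : Finite (W.KerG κ 0))
    [Finite (FixedPoints.addSubgroup κ.kerSubgroup (geomPrimaryTorsion W p))]
    (hnf : Module.Finite (IwasawaAlgebra p) D.X → Module.IsTorsion (IwasawaAlgebra p) D.X →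
      ∀ N : Submodule (IwasawaAlgebra p) D.X, Finite N → N = ⊥)
    (f : IwasawaAlgebra p) (hf : D.charIdeal = Ideal.span {f}) :
    ((Nat.card ↥(W.selmerGroupPInfty p) * Nat.card (W.KerG κ 0) : ℕ) : ℤ_[p]) ∣
      PowerSeries.constantCoeff f *
        (Nat.card (MulAction.fixedPoints (Field.absoluteGaloisGroup K) (geomPrimaryTorsion W p)) :
          ℤ_[p]) := by
  obtain ⟨-, -, -, -, u, hu⟩ :=
    constantCoeff_mul_natCard_fixedPoints_eq_of_forall_finite_eq_bot W D hγ hSel hg hnf f hf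
  refine ⟨↑u, ?_⟩
  rw [hu, Nat.cast_mul]
  ring

/-- **THE UPPER HALF OF CONTROL: `#Sel_{p^∞}(E/K) · #ker g_0 ∣ f(0)` in `ℤ_p`**, i.e.
`ord_p #Sel_{p^∞}(E/K) + ord_p #ker g_0 ≤ ord_p f(0)` — for `E/K` elliptic over a number field, ANY
`ℤ_p`-extension with topological generator `γ`, any dual datum, any generator `f` of `char_Λ X`,
granted: `Sel_{p^∞}(E/K)` finite, `ker g_0` finite, `E(K)[p] = 0`, and "no non-zero finite
`Λ`-submodule" for the (then finitely generated torsion) `X`. NO local input whatsoever: the unknown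
group `ker g_0 = A_0/Sel_0` only HELPS on this side. [cite: GreenbergLNM1716, §4 Thm. 4.1 (proof, pp. 102–104) and Prop. 4.14] -/
theorem natCard_selmer_mul_natCard_kerG_dvd_constantCoeff_of_no_pTorsion
    (D : W.SelmerDualData κ γ) (hγ : κ.IsTopGenerator γ) (hSel : Finite ↥(W.selmerGroupPInfty p))
    (hg : Finite (W.KerG κ 0)) (hK : ∀ P : W.toAffine.Point, p • P = 0 → P = 0)
    (hnf : Module.Finite (IwasawaAlgebra p) D.X → Module.IsTorsion (IwasawaAlgebra p) D.X →
      ∀ N : Submodule (IwasawaAlgebra p) D.X, Finite N → N = ⊥)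
    (f : IwasawaAlgebra p) (hf : D.charIdeal = Ideal.span {f}) :
    ((Nat.card ↥(W.selmerGroupPInfty p) * Nat.card (W.KerG κ 0) : ℕ) : ℤ_[p]) ∣
      PowerSeries.constantCoeff f := by
  haveI := W.finite_fixedPoints_kerSubgroup_geomPrimaryTorsion κ hK
  have h := natCard_selmer_mul_natCard_kerG_dvd_constantCoeff_mul_natCard_fixedPoints W D hγ hSel hg
    hnf f hf
  rwa [W.natCard_fixedPoints_absoluteGaloisGroup_geomPrimaryTorsion_eq_one hK, Nat.cast_one,
    mul_one] at h

/-- Generator-free form: **`#Sel_{p^∞}(E/K) · #ker g_0 ∣ g(0)` for EVERY `g ∈ char_Λ X(E/K_∞)`**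
(`char_Λ X` is principal; `g = h · f` and `g(0) = h(0) · f(0)`).
[cite: GreenbergLNM1716, §4 Thm. 4.1 (proof, pp. 102–104) and Prop. 4.14] -/
theorem natCard_selmer_mul_natCard_kerG_dvd_constantCoeff_of_mem_charIdeal_of_no_pTorsion
    (D : W.SelmerDualData κ γ) (hγ : κ.IsTopGenerator γ) (hSel : Finite ↥(W.selmerGroupPInfty p))
    (hg : Finite (W.KerG κ 0)) (hK : ∀ P : W.toAffine.Point, p • P = 0 → P = 0)
    (hnf : Module.Finite (IwasawaAlgebra p) D.X → Module.IsTorsion (IwasawaAlgebra p) D.X →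
      ∀ N : Submodule (IwasawaAlgebra p) D.X, Finite N → N = ⊥)
    {g : IwasawaAlgebra p} (hg' : g ∈ D.charIdeal) :
    ((Nat.card ↥(W.selmerGroupPInfty p) * Nat.card (W.KerG κ 0) : ℕ) : ℤ_[p]) ∣
      PowerSeries.constantCoeff g := by
  haveI : (Module.charIdeal (IwasawaAlgebra p) D.X).IsPrincipal := charIdeal_isPrincipal_holds p D.X
  obtain ⟨f, hchar⟩ := Submodule.IsPrincipal.principal (Module.charIdeal (IwasawaAlgebra p) D.X)
  have hf : D.charIdeal = Ideal.span {f} := hchar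
  have hgf : g ∈ Ideal.span {f} := hf ▸ hg'
  obtain ⟨h, rfl⟩ := Ideal.mem_span_singleton'.mp hgf
  rw [map_mul]
  exact (natCard_selmer_mul_natCard_kerG_dvd_constantCoeff_of_no_pTorsion W D hγ hSel hg hK hnf f
    hf).mul_left _

/-- **Finite-set form: `#Sel_{p^∞}(E/K) · #ker g_0 ∣ f(0)`** with `ker g_0` made finite by CONTROL —
`S` a finite set of places off which every place is prime to `p` and good; ABOVE `p` on `S` only the
FINITENESS of `𝒦_{v,0}[p^∞]` is asked (`hSp`); at `v ∤ p` finiteness is a theorem of the tree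
(Greenberg's Lemma 3.3, `finite_localTowerKerPrimary_zero_of_not_mem`), and `#ker g_0 ∣ ∏_{v∈S} #𝒦_{v,0}[p^∞]`
(FILE T-CTL-TAM 1). [cite: GreenbergLNM1716, §4 Thm. 4.1 (proof, pp. 102–104), Prop. 4.14 and §3 Lemma 3.3, Lemma 3.5] -/
theorem natCard_selmer_mul_natCard_kerG_dvd_constantCoeff_of_no_pTorsion_of_good
    (D : W.SelmerDualData κ γ) (hγ : κ.IsTopGenerator γ) (hSel : Finite ↥(W.selmerGroupPInfty p))
    (hK : ∀ P : W.toAffine.Point, p • P = 0 → P = 0)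
    (hnf : Module.Finite (IwasawaAlgebra p) D.X → Module.IsTorsion (IwasawaAlgebra p) D.X →
      ∀ N : Submodule (IwasawaAlgebra p) D.X, Finite N → N = ⊥)
    (f : IwasawaAlgebra p) (hf : D.charIdeal = Ideal.span {f})
    (S : Finset (HeightOneSpectrum (𝓞 K)))
    (hSp : ∀ v ∈ S, (p : 𝓞 K) ∈ v.asIdeal → Finite (W.localTowerKerPrimary κ (v.adicCompletion K) 0))
    (hgood : ∀ v ∉ S, (p : 𝓞 K) ∉ v.asIdeal ∧ W.HasGoodReductionAt v) :
    Finite (W.KerG κ 0) ∧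
      ((Nat.card ↥(W.selmerGroupPInfty p) * Nat.card (W.KerG κ 0) : ℕ) : ℤ_[p]) ∣
        PowerSeries.constantCoeff f := by
  have hS := finite_localTowerKerPrimary_zero_on_finset W κ S hSp
  obtain ⟨hg, -⟩ := finite_kerG_zero_and_natCard_dvd_prod_of_good W κ S hS hgood
  exact ⟨hg, natCard_selmer_mul_natCard_kerG_dvd_constantCoeff_of_no_pTorsion W D hγ hSel hg hK hnf f hf⟩

/-- **TWO-SIDED control**: `#Sel_{p^∞}(E/K) · #ker g_0 ∣ f(0) ∣ #Sel_{p^∞}(E/K) · ∏_{v∈S} #𝒦_{v,0}[p^∞]`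
(the lower side is FILE T-CTL-TAM 1, `constantCoeff_dvd_natCard_selmer_mul_prod_of_no_pTorsion_of_good`;
the upper side this file) — `ord_p f(0)` is pinned in the window
`[ord_p #Sel + ord_p #ker g_0, ord_p #Sel + Σ_{v∈S} ord_p #𝒦_{v,0}[p^∞]]`.
[cite: GreenbergLNM1716, §4 Thm. 4.1 (proof, pp. 102–104), Prop. 4.14 and §3 Lemma 3.3, Lemma 3.5] -/
theorem natCard_selmer_mul_natCard_kerG_dvd_constantCoeff_and_dvd_of_no_pTorsion_of_good
    (D : W.SelmerDualData κ γ) (hγ : κ.IsTopGenerator γ) (hSel : Finite ↥(W.selmerGroupPInfty p))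
    (hK : ∀ P : W.toAffine.Point, p • P = 0 → P = 0)
    (hnf : Module.Finite (IwasawaAlgebra p) D.X → Module.IsTorsion (IwasawaAlgebra p) D.X →
      ∀ N : Submodule (IwasawaAlgebra p) D.X, Finite N → N = ⊥)
    (f : IwasawaAlgebra p) (hf : D.charIdeal = Ideal.span {f})
    (S : Finset (HeightOneSpectrum (𝓞 K)))
    (hSp : ∀ v ∈ S, (p : 𝓞 K) ∈ v.asIdeal → Finite (W.localTowerKerPrimary κ (v.adicCompletion K) 0))
    (hgood : ∀ v ∉ S, (p : 𝓞 K) ∉ v.asIdeal ∧ W.HasGoodReductionAt v) :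
    ((Nat.card ↥(W.selmerGroupPInfty p) * Nat.card (W.KerG κ 0) : ℕ) : ℤ_[p]) ∣
        PowerSeries.constantCoeff f ∧
      PowerSeries.constantCoeff f ∣
        ((Nat.card ↥(W.selmerGroupPInfty p) *
          ∏ v ∈ S, Nat.card (W.localTowerKerPrimary κ (v.adicCompletion K) 0) : ℕ) : ℤ_[p]) := by
  have hS := finite_localTowerKerPrimary_zero_on_finset W κ S hSp
  exact ⟨(natCard_selmer_mul_natCard_kerG_dvd_constantCoeff_of_no_pTorsion_of_good W D hγ hSel hK hnf f
      hf S hSp hgood).2,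
    constantCoeff_dvd_natCard_selmer_mul_prod_of_no_pTorsion_of_good W D hγ hSel hK f hf S hS hgood⟩

/-- **EXACT value on trivial-kernel rows: `f(0) = u · #Sel_{p^∞}(E/K)`**, `u ∈ ℤ_pˣ`, when every
level-`0` local tower kernel on `S` has trivial `p`-power torsion (then `ker g_0 = 0`, row T-CTL-EC)
and `X` has no non-zero finite `Λ`-submodule: the Perrin-Riou–Schneider / Greenberg Thm. 4.1 value
`ord_p f(0) = ord_p #Sel_{p^∞}(E/K)` on those rows, from control + the no-finite-submodule input ALONE
(no Lemma 4.4, no Lemma 4.7). [cite: GreenbergLNM1716, §4 Thm. 4.1 (proof, pp. 102–104), Prop. 4.14 and §3 Prop. 3.8] -/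
theorem constantCoeff_eq_unit_mul_natCard_selmer_of_localTowerKerPrimary_eq_bot
    (D : W.SelmerDualData κ γ) (hγ : κ.IsTopGenerator γ) (hSel : Finite ↥(W.selmerGroupPInfty p))
    (hK : ∀ P : W.toAffine.Point, p • P = 0 → P = 0)
    (hnf : Module.Finite (IwasawaAlgebra p) D.X → Module.IsTorsion (IwasawaAlgebra p) D.X →
      ∀ N : Submodule (IwasawaAlgebra p) D.X, Finite N → N = ⊥)
    (f : IwasawaAlgebra p) (hf : D.charIdeal = Ideal.span {f})
    (S : Finset (HeightOneSpectrum (𝓞 K)))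
    (hS : ∀ v ∈ S, W.localTowerKerPrimary κ (v.adicCompletion K) 0 = ⊥)
    (hgood : ∀ v ∉ S, (p : 𝓞 K) ∉ v.asIdeal ∧ W.HasGoodReductionAt v) :
    ∃ u : ℤ_[p]ˣ, PowerSeries.constantCoeff f = u * Nat.card ↥(W.selmerGroupPInfty p) := by
  have h0 := localTowerKerPrimary_zero_eq_bot_of_finset W κ S hS hgood
  haveI hsub := subsingleton_kerG_zero_of_localTowerKerPrimary_eq_bot W κ h0
  have hg : Finite (W.KerG κ 0) := Finite.of_subsingleton
  obtain ⟨-, -, -, -, u, hu⟩ :=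
    constantCoeff_eq_unit_mul_natCard_selmer_mul_natCard_kerG_of_no_pTorsion W D hγ hSel hg hK hnf f hf
  refine ⟨u, ?_⟩
  rw [hu, natCard_kerG_zero_eq_one_of_localTowerKerPrimary_eq_bot W κ h0, Nat.cast_one, mul_one]

end Upper

/-! ## §4. `K = ℚ`: Greenberg's Prop. 4.14 record BY NAME -/

section Rat

variable (W : WeierstrassCurve ℚ) [W.IsElliptic] [W.IsGloballyMinimal] {p : ℕ} [hp : Fact p.Prime]
  {κ : ZpExtension ℚ p} {γ : Field.absoluteGaloisGroup ℚ}

/-- The no-finite-submodule input over `ℚ` from the record: `W` globally minimal, `p ∤ #E(ℚ)_tors`,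
`κ` CYCLOTOMIC. [cite: GreenbergLNM1716, Prop. 4.14] [cite: HachimoriMatsuno2000, Corollary (i) (p. 2540)] -/
theorem forall_finite_eq_bot_of_prop414
    (h414 : Greenberg1999.prop414_noFiniteSubmodule_of_not_dvd_torsionOrder)
    (htors : ¬ p ∣ W.torsionOrder) (hκ : κ.IsCyclotomic) (hγ : κ.IsTopGenerator γ)
    (D : W.SelmerDualData κ γ) :
    Module.Finite (IwasawaAlgebra p) D.X → Module.IsTorsion (IwasawaAlgebra p) D.X →
      ∀ N : Submodule (IwasawaAlgebra p) D.X, Finite N → N = ⊥ := by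
  intro hFG hT N hN
  haveI := hFG
  exact h414 W p htors κ γ hκ hγ D hT N hN

/-- **`K = ℚ`: `#Sel_{p^∞}(E/ℚ) · #ker g_0 ∣ f(0)` modulo Greenberg's Prop. 4.14 record** — `W` globally
minimal, `p ∤ #E(ℚ)_tors`, `κ` cyclotomic with topological generator `γ`, any dual datum `D`, any
generator `f`; `Sel_{p^∞}(E/ℚ)` finite; `S ⊇ {p} ∪ {bad}` with the level-`0` kernels FINITE above `p`.
Also returns `X` finitely generated torsion, `f(0) ≠ 0`, `ker g_0` finite.
[cite: GreenbergLNM1716, §4 Thm. 4.1 (proof, pp. 102–104), Prop. 4.14, §3 Lemmas 3.3/3.5] -/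
theorem natCard_selmer_mul_natCard_kerG_dvd_constantCoeff_of_prop414
    (h414 : Greenberg1999.prop414_noFiniteSubmodule_of_not_dvd_torsionOrder)
    (htors : ¬ p ∣ W.torsionOrder) (hκ : κ.IsCyclotomic) (hγ : κ.IsTopGenerator γ)
    (D : W.SelmerDualData κ γ) (hSel : Finite ↥(W.selmerGroupPInfty p))
    (f : IwasawaAlgebra p) (hf : D.charIdeal = Ideal.span {f})
    (S : Finset (HeightOneSpectrum (𝓞 ℚ)))
    (hSp : ∀ v ∈ S, (p : 𝓞 ℚ) ∈ v.asIdeal → Finite (W.localTowerKerPrimary κ (v.adicCompletion ℚ) 0))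
    (hgood : ∀ v ∉ S, (p : 𝓞 ℚ) ∉ v.asIdeal ∧ W.HasGoodReductionAt v) :
    Finite (W.KerG κ 0) ∧
      ((Nat.card ↥(W.selmerGroupPInfty p) * Nat.card (W.KerG κ 0) : ℕ) : ℤ_[p]) ∣
        PowerSeries.constantCoeff f :=
  natCard_selmer_mul_natCard_kerG_dvd_constantCoeff_of_no_pTorsion_of_good W D hγ hSel
    (forall_smul_eq_zero_imp_of_not_dvd_torsionOrder W htors)
    (forall_finite_eq_bot_of_prop414 W h414 htors hκ hγ D) f hf S hSp hgood

/-- **`K = ℚ`, generator-free: `#Sel_{p^∞}(E/ℚ) ∣ g(0)` for EVERY `g ∈ char_Λ X(E/ℚ_∞)`**, modulo the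
Prop. 4.14 record (same hypotheses). [cite: GreenbergLNM1716, §4 Thm. 4.1 (proof, pp. 102–104), Prop. 4.14] -/
theorem natCard_selmer_dvd_constantCoeff_of_mem_charIdeal_of_prop414
    (h414 : Greenberg1999.prop414_noFiniteSubmodule_of_not_dvd_torsionOrder)
    (htors : ¬ p ∣ W.torsionOrder) (hκ : κ.IsCyclotomic) (hγ : κ.IsTopGenerator γ)
    (D : W.SelmerDualData κ γ) (hSel : Finite ↥(W.selmerGroupPInfty p))
    (S : Finset (HeightOneSpectrum (𝓞 ℚ)))
    (hSp : ∀ v ∈ S, (p : 𝓞 ℚ) ∈ v.asIdeal → Finite (W.localTowerKerPrimary κ (v.adicCompletion ℚ) 0))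
    (hgood : ∀ v ∉ S, (p : 𝓞 ℚ) ∉ v.asIdeal ∧ W.HasGoodReductionAt v)
    {g : IwasawaAlgebra p} (hg : g ∈ D.charIdeal) :
    (Nat.card ↥(W.selmerGroupPInfty p) : ℤ_[p]) ∣ PowerSeries.constantCoeff g := by
  have hS := finite_localTowerKerPrimary_zero_on_finset W κ S hSp
  obtain ⟨hfin, -⟩ := finite_kerG_zero_and_natCard_dvd_prod_of_good W κ S hS hgood
  exact (Dvd.intro _ (Nat.cast_mul _ _).symm).trans
    (natCard_selmer_mul_natCard_kerG_dvd_constantCoeff_of_mem_charIdeal_of_no_pTorsion W D hγ hSel hfin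
      (forall_smul_eq_zero_imp_of_not_dvd_torsionOrder W htors)
      (forall_finite_eq_bot_of_prop414 W h414 htors hκ hγ D) hg)

/-- **`K = ℚ`, rank `0` (`E(ℚ)` finite), `Ш`-currency: `#Ш(E/ℚ)[p^∞] ∣ g(0)` for every
`g ∈ char_Λ X(E/ℚ_∞)`**, modulo the Prop. 4.14 record — `ord_p #Ш(E/ℚ) ≤ ord_p g(0)`: the UPPER
half of control over `ℚ` in the shape Delbourgo 1998 Prop. 4 / Greenberg Thm. 4.1 deliver it, but
WITHOUT the Tamagawa term (not claimed) and WITHOUT any reduction hypothesis at `p` beyond the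
finiteness of the level-`0` local tower kernel above `p`. (`#Sel_{p^∞}(E/ℚ) = #Ш[p^∞]` for finite
`E(ℚ)`, tree `card_selmerGroupPInfty_eq_card_primaryComponent_sha`.)
[cite: GreenbergLNM1716, §4 Thm. 4.1 (proof, pp. 102–104), Prop. 4.14] -/
theorem natCard_primaryComponent_sha_dvd_constantCoeff_of_prop414 [Finite W.toAffine.Point]
    [Finite (AddCommGroup.primaryComponent W.sha p)]
    (h414 : Greenberg1999.prop414_noFiniteSubmodule_of_not_dvd_torsionOrder)
    (htors : ¬ p ∣ W.torsionOrder) (hκ : κ.IsCyclotomic) (hγ : κ.IsTopGenerator γ)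
    (D : W.SelmerDualData κ γ) (S : Finset (HeightOneSpectrum (𝓞 ℚ)))
    (hSp : ∀ v ∈ S, (p : 𝓞 ℚ) ∈ v.asIdeal → Finite (W.localTowerKerPrimary κ (v.adicCompletion ℚ) 0))
    (hgood : ∀ v ∉ S, (p : 𝓞 ℚ) ∉ v.asIdeal ∧ W.HasGoodReductionAt v)
    {g : IwasawaAlgebra p} (hg : g ∈ D.charIdeal) :
    (Nat.card (AddCommGroup.primaryComponent W.sha p) : ℤ_[p]) ∣ PowerSeries.constantCoeff g := by
  rw [← W.card_selmerGroupPInfty_eq_card_primaryComponent_sha p]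
  exact natCard_selmer_dvd_constantCoeff_of_mem_charIdeal_of_prop414 W h414 htors hκ hγ D
    (W.finite_selmerGroupPInfty_of_finite_primaryComponent p) S hSp hgood hg

end Rat

end Summit.BirchSwinnertonDyer.Rank1Residual.Iwasawa

end
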